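import Literature.NumberTheory.Rogawski1990.PreStabilisationSingularSelf
import Literature.NumberTheory.Rogawski1990.AdelicClassOrbitalIntegralFiniteSupportG2Semisimple
import HarnessLib

/-!
# The elliptic pre-stabilisation AT A SPLIT SEMISIMPLE CLASS of the anisotropic inner form, `|𝓡| = 2`, AT THE KIT'S FAMILY `ofLocalAdelic mG mGi` and an
# `IsTest` pure tensor — `hfin` discharged (Rogawski 1990, §5.4 (5.4.1)–(5.4.3) pp. 72–73; §3.8 Prop. 3.8.1 p. 27; §14.5 pp. 238–239; Kottwitz 1986 §9)

Topic `NumberTheory/Rogawski1990`; namespace `Literature.NumberTheory.Rogawski1990`; **THEOREMS ONLY** (no definition, no named fact, no instance,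
no notation, no `sorry`).  Cell `pub/hodgecm-mathlib`, ENGINE T1 (crux H413 = `stmt-HodgeConjecture-24833`), row O7 «singular semisimple classes», piece
**(D1-s) FILE 3** (O7 OWNER WORD #16): ★ (D1-s) FILE 1 `MatchingAdeleG₂.stableOrbitalSum_map_toAdelic_eq_half_of_singularObs` (the `|𝓡| = 2` count, generic family)
at the kit's restricted-product family `m := ofLocalAdelic L 3 H mG mGi`, `f := T.eval`, with its `hfin` DISCHARGED by ★ (D1-s) FILE 2
`MatchingAdeleG₂.finite_classes_inter_support_classOrbitalIntegral_ofLocalAdelic_of_mul_sub_eq_zero` at `H₁ = H₂ = H`, `γ := γ₀` — the singular twin of ★ O11-1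
`MatchingAdeleG₂.stableOrbitalSum_map_toAdelic_ofLocalAdelic_eq_of_equiv`, kit-side binders only (class-local admissibility at the classes corresponding to
`(γ₀)_v` ∕ `γ₀ ⊗ 1`, normalisation at `toAdelic γ₀` and at every matching adèle, `IsTest`), HYPOTHESES-FIRST in `hHasse` (singular ObsHasse) and the κ-weight `W`.

* **`MatchingAdeleG₂.stableOrbitalSum_map_toAdelic_ofLocalAdelic_eq_half_of_singularObs`** —
  `Σ_{[γ] ⊂ 𝒪_st(γ₀)} Φ_{ofLocalAdelic mG mGi}([γ ⊗ 1], T.eval) = 2⁻¹ · (adelicStableOrbitalSum 𝒞′_𝐀(γ₀) (ofLocalAdelic mG mGi) T.eval + adelicKappaOrbitalSum 𝒞′_𝐀(γ₀) W (ofLocalAdelic mG mGi) T.eval)`.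

HONEST LABEL: nothing printed is consumed; HC_CM is proved only modulo the printed citations until rung 0 closes.

## References
* [Rogawski1990] J. D. Rogawski, *Automorphic Representations of Unitary Groups in Three Variables*, Ann. of Math. Stud. 123 (1990), §3.3 Prop. 3.3.1 p. 22,
  §3.8 Prop. 3.8.1 p. 27, §4.3 p. 44, §5.4 (5.4.1)–(5.4.3) pp. 72–73, §14.5 pp. 238–239.
* [Kottwitz1986] R. E. Kottwitz, *Stable trace formula: elliptic singular terms*, Math. Ann. 275 (1986), Prop. 7.1, §9.
-/

set_option autoImplicit false

noncomputable section

open NumberField IsDedekindDomain Function MeasureTheory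
open scoped Matrix MatrixGroups

namespace Literature.NumberTheory.Rogawski1990

open Literature.NumberTheory.Automorphic
open Literature.AlgebraicGeometry.ShimuraVarieties (unitaryGroup hermForm)

section Kit

variable {L : Type} [Field L] [NumberField L] [IsCMField L] {H : Matrix (Fin 3) (Fin 3) L} {γ₀ : (UnitaryGroup.cmDatum L 3 H).Rational} {a b : L}
  [∀ g : (UnitaryGroup.cmDatum L 3 H).Adelic,
    MeasurableSpace ((UnitaryGroup.cmDatum L 3 H).Adelic ⧸ Subgroup.centralizer ({g} : Set (UnitaryGroup.cmDatum L 3 H).Adelic))]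
  [∀ g : (UnitaryGroup.cmDatum L 3 H).Adelic,
    BorelSpace ((UnitaryGroup.cmDatum L 3 H).Adelic ⧸ Subgroup.centralizer ({g} : Set (UnitaryGroup.cmDatum L 3 H).Adelic))]
  [∀ (v : HeightOneSpectrum (𝓞 ↥(maximalRealSubfield L))) (x : (UnitaryGroup.cmDatum L 3 H).Local v),
    MeasurableSpace ((UnitaryGroup.cmDatum L 3 H).Local v ⧸ Subgroup.centralizer ({x} : Set ((UnitaryGroup.cmDatum L 3 H).Local v)))]
  [∀ (v : HeightOneSpectrum (𝓞 ↥(maximalRealSubfield L))) (x : (UnitaryGroup.cmDatum L 3 H).Local v),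
    BorelSpace ((UnitaryGroup.cmDatum L 3 H).Local v ⧸ Subgroup.centralizer ({x} : Set ((UnitaryGroup.cmDatum L 3 H).Local v)))]
  [∀ a : UnitaryGroup.arch (↥(maximalRealSubfield L)) L (IsCMField.complexConj L) 3 H,
    MeasurableSpace (UnitaryGroup.arch (↥(maximalRealSubfield L)) L (IsCMField.complexConj L) 3 H ⧸
      Subgroup.centralizer ({a} : Set (UnitaryGroup.arch (↥(maximalRealSubfield L)) L (IsCMField.complexConj L) 3 H)))]
  [∀ a : UnitaryGroup.arch (↥(maximalRealSubfield L)) L (IsCMField.complexConj L) 3 H,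
    BorelSpace (UnitaryGroup.arch (↥(maximalRealSubfield L)) L (IsCMField.complexConj L) 3 H ⧸
      Subgroup.centralizer ({a} : Set (UnitaryGroup.arch (↥(maximalRealSubfield L)) L (IsCMField.complexConj L) 3 H)))]

/-- **THE PRE-STABILISATION COUNT AT A SPLIT SEMISIMPLE CLASS, `|𝓡| = 2`, AT THE KIT'S FAMILY `ofLocalAdelic mG mGi` AND AN `IsTest` PURE TENSOR** (`hfin`
discharged).  `H` anisotropic hermitian; `γ₀ ∈ U(H)(L⁺)` with `(γ₀ − a)(γ₀ − b) = 0`, `a ≠ b`; the singular Hasse principle `hHasse` for ★ `singularObs` (binder); the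
κ-weight `W` on the adelic classes (`hW`, the text of pin `PinSingularKappaHalf`); local families `mG v` and `mGi` ADMISSIBLE on the classes corresponding to `(γ₀)_v` ∕
`γ₀ ⊗ 1` (self carrier); `mG` normalised off a finite set at `toAdelic γ₀` and at every matching adèle; `T` an `IsTest` pure tensor on `U(H)(𝐀)`.  THEN
`Σ_{[γ] ⊂ 𝒪_st(γ₀)} Φ_{ofLocalAdelic mG mGi}([toAdelic γ], T.eval) = 2⁻¹ · (adelicStableOrbitalSum 𝒞′_𝐀(γ₀) (ofLocalAdelic mG mGi) T.eval + adelicKappaOrbitalSum 𝒞′_𝐀(γ₀) W (ofLocalAdelic mG mGi) T.eval)`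
(★ FILE 1 with `hfin :=` ★ FILE 2 `…_of_mul_sub_eq_zero` at `H₁ = H₂ = H`, `γ := γ₀`). [cite: Rogawski1990, §5.4 (5.4.1)–(5.4.3) pp. 72–73; §3.8 Prop. 3.8.1 (d) p. 27; §14.5 pp. 238–239]
[cite: Kottwitz1986, Prop. 7.1, §9] -/
theorem MatchingAdeleG₂.stableOrbitalSum_map_toAdelic_ofLocalAdelic_eq_half_of_singularObs (hH : (H.map (cmConjRingHom L))ᵀ = H)
    (hanis : ∀ x : Fin 3 → L, hermForm (cmConjRingHom L) H x x = 0 → x = 0)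
    (hab : a ≠ b)
    (hγ₀ : ((((γ₀ : unitaryGroup (cmConjRingHom L) H).val : GL (Fin 3) L) : Matrix (Fin 3) (Fin 3) L) - a • (1 : Matrix (Fin 3) (Fin 3) L)) *
      ((((γ₀ : unitaryGroup (cmConjRingHom L) H).val : GL (Fin 3) L) : Matrix (Fin 3) (Fin 3) L) - b • (1 : Matrix (Fin 3) (Fin 3) L)) = 0)
    (hHasse : ∀ p : MatchingAdeleG₂ L H H γ₀, p.singularObs hab hγ₀ = 0 ↔ ∃ γ : (UnitaryGroup.cmDatum L 3 H).Rational, p.IsRationalOver γ)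
    (W : ConjClasses (UnitaryGroup.cmDatum L 3 H).Adelic → ℂ)
    (hW : ∀ q : MatchingAdeleG₂ L H H γ₀, W (ConjClasses.mk q.adele) = if q.singularObs hab hγ₀ = 0 then 1 else -1)
    (mG : ∀ v : HeightOneSpectrum (𝓞 ↥(maximalRealSubfield L)), OrbitalMeasureFamily ((UnitaryGroup.cmDatum L 3 H).Local v))
    (mGi : OrbitalMeasureFamily (UnitaryGroup.arch (↥(maximalRealSubfield L)) L (IsCMField.complexConj L) 3 H))
    (hadm : ∀ v, (mG v).IsAdmissibleOn fun x : (UnitaryGroup.cmDatum L 3 H).Local v =>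
      Corresponds (UnitaryGroup.conjLocal L (IsCMField.complexConj L) v)
        ((UnitaryGroup.adelicForm L 3 H).map (UnitaryGroup.adeleToLocal L v))
        ((UnitaryGroup.adelicForm L 3 H).map (UnitaryGroup.adeleToLocal L v))
        ((UnitaryGroup.cmDatum L 3 H).toLocal v ((UnitaryGroup.cmDatum L 3 H).toAdelic γ₀)) x)
    (hadmA : mGi.IsAdmissibleOn fun a : UnitaryGroup.arch (↥(maximalRealSubfield L)) L (IsCMField.complexConj L) 3 H =>
      Corresponds (UnitaryGroup.conjMixed (↥(maximalRealSubfield L)) L (IsCMField.complexConj L)) (UnitaryGroup.archFormOf L 3 H)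
        (UnitaryGroup.archFormOf L 3 H) (cmRationalToArch L 3 H γ₀) a)
    (hnormγ : ∃ S₀ : Finset (HeightOneSpectrum (𝓞 ↥(maximalRealSubfield L))),
      UnitaryGroup.IsNormalisedOff L 3 H mG ((UnitaryGroup.cmDatum L 3 H).toAdelic γ₀) S₀)
    (hnorm : ∀ p : MatchingAdeleG₂ L H H γ₀, ∃ S₀ : Finset (HeightOneSpectrum (𝓞 ↥(maximalRealSubfield L))),
      UnitaryGroup.IsNormalisedOff L 3 H mG p.adele S₀)
    (T : UnitaryGroup.PureTensor L 3 H) (hT : T.IsTest) :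
    stableOrbitalSum (cmConjRingHom L) H (fun c => classOrbitalIntegral (UnitaryGroup.OrbitalMeasureFamily.ofLocalAdelic L 3 H mG mGi) T.eval
        (ConjClasses.map (UnitaryGroup.cmDatum L 3 H).toAdelic c)) γ₀ =
      (2 : ℂ)⁻¹ * (adelicStableOrbitalSum (MatchingAdeleG₂.classes L H H γ₀) (UnitaryGroup.OrbitalMeasureFamily.ofLocalAdelic L 3 H mG mGi) T.eval +
        adelicKappaOrbitalSum (MatchingAdeleG₂.classes L H H γ₀) W (UnitaryGroup.OrbitalMeasureFamily.ofLocalAdelic L 3 H mG mGi) T.eval) := by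
  have hdet : H.det ≠ 0 := Godement.det_ne_zero_of_anisotropic L H hanis
  exact MatchingAdeleG₂.stableOrbitalSum_map_toAdelic_eq_half_of_singularObs hH (isUnit_iff_ne_zero.2 hdet) hanis hab hγ₀ hHasse W hW _ T.eval
    (MatchingAdeleG₂.finite_classes_inter_support_classOrbitalIntegral_ofLocalAdelic_of_mul_sub_eq_zero hH hdet (γ := γ₀) (IsConj.refl _) hab hγ₀ mG mGi
      hadm hadmA hnormγ hnorm T hT)

end Kit

end Literature.NumberTheory.Rogawski1990

end
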